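import Summits.CriticalPhenomena.Ising3DConformalLimit.Theses.MoebiusRestrictionCurrents
import Summits.CriticalPhenomena.Ising3DConformalLimit.Theorems.MoebiusLimitExists.Negative.PinnedClusterPoints

/-!
# `TargetSuffices` — the glue from the route target (domain Möbius theory) to the conjunct

Route `route-CriticalPhenomena-MoebiusRestrictionCurrents`, item `stmt-CriticalPhenomena-4860`
(support, rank 9): `Target → IsingEuclidUpgradeR4NonGaussian → FreeIsCritical → Ising3DConformalLimit`.

Proof (bookkeeping only, as announced in the route file). From `Target` take `Δ > 0` and the
domain-indexed limits `S D n`. Put `ρ := ρ₀` (the canonical renormalisation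
`ρ₀(δ) = ⟨σ₀σ_{[e₁/δ]}⟩_{β_c}^{-1/2}`, positive because the critical two-point function of `ℤ³` is
positive, tree theorem `PinnedClusterPoints.criticalTwoPoint_pos3`) and `S' n x := S univ n x` on injective `x`, `0` otherwise.
* For `δ > 0` the lattice approximation `[·/δ]` maps `ℝ³ ∖ {0}` ONTO `ℤ³`, so the discretisations of
  `D = ℝ³` and of `D = ℝ³ ∖ {0}` are both the whole box, and `FreeIsCritical` (free box limit =
  critical correlator) identifies the route's `limUnder` with `criticalCorr 3`; hence clause (i) of
  `Target` for `D = univ` is `HasPointwiseScalingLimit (criticalCorr 3) ρ₀ S'`, and by uniqueness of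
  locally uniform limits `S {0}ᶜ n = S univ n` on non-coincident configurations avoiding `0`.
* Non-degeneracy is clause (ii); translation / `O(3)` / dilation covariance are clause (iii) with
  `D = univ` (the images are `univ`); inversion covariance is clause (iii) with `D = {0}ᶜ`
  (admissible: open with frontier `{0}`, a Lebesgue-null set; `ι '' {0}ᶜ = {0}ᶜ`) transported to
  `S univ` by the identification above; non-injective configurations stay non-injective under the
  (injective) Möbius generators, where both sides vanish.
* `U₄ ≢ 0` is the shared crux `IsingEuclidUpgradeR4NonGaussian` applied to `(ρ₀, S')`.

No named facts are used (the only lattice input, positivity of the critical two-point function,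
is the proved tree theorem `PinnedClusterPoints.criticalTwoPoint_pos3`).
References: Di Francesco–Mathieu–Sénéchal 1997, §4.1, §4.3.1 (Möbius generators and covariance);
Duminil-Copin, ICM 2022, §8.1 (the covariance reading of conformal invariance).
-/

noncomputable section

namespace Summit.CriticalPhenomena.Ising3DConformalLimit.Theorems

open Summit.CriticalPhenomena.Ising3DConformalLimit.Theses.MoebiusRestrictionCurrents
open Literature.Probability.LatticeModels
open Filter Topology Set Function EuclideanGeometry MeasureTheory

namespace MoebiusRestrictionCurrentsTargetSuffices

/-! ### Admissibility of `ℝ³` and `ℝ³ ∖ {0}` -/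

/-- `ℝ³` is an admissible domain: open with Lebesgue-null (empty) frontier. [folklore] -/
theorem adm_univ :
    IsOpen (univ : Set (EuclideanSpace ℝ (Fin 3))) ∧
      volume (frontier (univ : Set (EuclideanSpace ℝ (Fin 3)))) = 0 := by
  refine ⟨isOpen_univ, ?_⟩
  rw [frontier_univ]
  exact measure_empty

/-- `ℝ³ ∖ {0}` is an admissible domain: open, with frontier `{0}`, a Lebesgue-null set. [folklore] -/
theorem adm_compl_zero :
    IsOpen (({0}ᶜ : Set (EuclideanSpace ℝ (Fin 3)))) ∧
      volume (frontier (({0}ᶜ : Set (EuclideanSpace ℝ (Fin 3))))) = 0 := by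
  refine ⟨isOpen_compl_singleton, ?_⟩
  rw [frontier_compl]
  refine measure_mono_null (frontier_subset_closure.trans (closure_singleton).subset) ?_
  exact measure_singleton _

/-! ### The lattice approximation is onto, even from `ℝ³ ∖ {0}` -/

/-- For `δ ≠ 0` every site `z ∈ ℤ³` is the lattice approximation `[x/δ]` of a point `x ≠ 0` of
`ℝ³` (take `xᵢ = δ (zᵢ + 1/2)`). [folklore] -/
theorem exists_ne_zero_latticeApprox_eq {δ : ℝ} (hδ : δ ≠ 0) (z : Site 3) :
    ∃ x : EuclideanSpace ℝ (Fin 3), x ≠ 0 ∧ latticeApprox δ x = z := by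
  have hfl : ∀ i : Fin 3, ⌊δ * ((z i : ℝ) + 1 / 2) / δ⌋ = z i := by
    intro i
    rw [mul_div_cancel_left₀ _ hδ, Int.floor_eq_iff]
    constructor <;> linarith
  refine ⟨WithLp.toLp 2 fun i : Fin 3 => δ * ((z i : ℝ) + 1 / 2), ?_, ?_⟩
  · intro h
    have h0 : δ * ((z 0 : ℝ) + 1 / 2) = 0 := by
      have := congrArg (fun x : EuclideanSpace ℝ (Fin 3) => x 0) h
      simpa using this
    have h1 : (z 0 : ℝ) + 1 / 2 = 0 := by
      rcases mul_eq_zero.1 h0 with h | h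
      · exact absurd h hδ
      · exact h
    have h2 := hfl 0
    rw [h1, mul_zero, zero_div, Int.floor_zero] at h2
    have h3 : ((z 0 : ℤ) : ℝ) = 0 := by exact_mod_cast h2.symm
    rw [h3, zero_add] at h1
    norm_num at h1
  · funext i
    rw [latticeApprox_apply]
    exact hfl i

/-- For `δ ≠ 0` and any `D ⊇ ℝ³ ∖ {0}` the discretisation predicate `z ∈ [D/δ]` holds at every
site, so filtering a box by it changes nothing. [folklore] -/
theorem filter_mem_image_eq {δ : ℝ} (hδ : δ ≠ 0) {D : Set (EuclideanSpace ℝ (Fin 3))}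
    (hD : ({0}ᶜ : Set (EuclideanSpace ℝ (Fin 3))) ⊆ D) (s : Finset (Site 3))
    {inst : DecidablePred fun z : Site 3 => z ∈ latticeApprox δ '' D} :
    @Finset.filter (Site 3) (fun z : Site 3 => z ∈ latticeApprox δ '' D) inst s = s := by
  refine Finset.filter_true_of_mem fun z _ => ?_
  obtain ⟨x, hx0, hx⟩ := exists_ne_zero_latticeApprox_eq hδ z
  exact ⟨x, hD hx0, hx⟩

/-! ### Positivity of the canonical renormalisation -/

/-- The canonical renormalisation `ρ₀(δ) = ⟨σ₀σ_{[e₁/δ]}⟩_{β_c}^{-1/2}` is positive, because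
`⟨σ₀σ_w⟩_{β_c} > 0` on `ℤ³` (tree theorem `criticalTwoPoint_pos3`, from the two-point lower bound
`criticalTwoPoint_bounds_holds`). [folklore] -/
theorem rho_pos (δ : ℝ) :
    0 < (Real.sqrt (criticalTwoPoint 3
      (latticeApprox δ (EuclideanSpace.single (0 : Fin 3) (1 : ℝ)))))⁻¹ :=
  inv_pos.2 (Real.sqrt_pos.2 (PinnedClusterPoints.criticalTwoPoint_pos3 _))

/-! ### Identification of the route's free-b.c. domain correlator with `criticalCorr 3` -/

/-- For `δ ≠ 0`, `D ⊇ ℝ³ ∖ {0}` and under `FreeIsCritical`, the route's discretised free-b.c.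
critical correlator of `D` (a `limUnder` over boxes) is the critical correlator `criticalCorr 3`
at the lattice approximations. [folklore] -/
theorem limUnder_eq_criticalCorr (hFree : FreeIsCritical) {δ : ℝ} (hδ : δ ≠ 0)
    {D : Set (EuclideanSpace ℝ (Fin 3))} (hD : ({0}ᶜ : Set (EuclideanSpace ℝ (Fin 3))) ⊆ D)
    (n : ℕ) (x : Fin n → EuclideanSpace ℝ (Fin 3))
    {inst : DecidablePred fun z : Site 3 => z ∈ latticeApprox δ '' D} :
    limUnder atTop (fun Lb : ℕ => isingExpect (zdGraph 3)
      (@Finset.filter (Site 3) (fun z => z ∈ latticeApprox δ '' D) inst (box 3 Lb))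
      (criticalBeta 3) 0
      BoundaryCondition.free (spinMonomial (fun i => latticeApprox δ (x i)))) =
      criticalCorr 3 n (fun i => latticeApprox δ (x i)) := by
  have h : (fun Lb : ℕ => isingExpect (zdGraph 3)
      (@Finset.filter (Site 3) (fun z => z ∈ latticeApprox δ '' D) inst (box 3 Lb))
      (criticalBeta 3) 0
      BoundaryCondition.free (spinMonomial (fun i => latticeApprox δ (x i)))) =
      fun Lb : ℕ => isingExpect (zdGraph 3) (box 3 Lb) (criticalBeta 3) 0
      BoundaryCondition.free (spinMonomial (fun i => latticeApprox δ (x i))) := by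
    funext Lb
    rw [filter_mem_image_eq hδ hD]
  rw [h]
  exact (hFree n _).limUnder_eq

/-! ### Extension by zero of an injectively-covariant family is Möbius covariant -/

/-- If a family `S₀` satisfies the Möbius covariance identities on injective configurations
(inversion: on injective configurations avoiding `0`), then its extension by `0` off the injective
configurations is Möbius covariant in the sense of `IsMoebiusCovariant` (all configurations):
the generators are injective maps, so non-injective configurations stay non-injective and both
sides vanish there. (Di Francesco–Mathieu–Sénéchal 1997, §4.1, §4.3.1.) [folklore] -/
theorem isMoebiusCovariant_extend {Δ : ℝ} (S₀ S' : CorrFamily 3)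
    (hS' : ∀ (n : ℕ) (x : Fin n → EuclideanSpace ℝ (Fin 3)),
      S' n x = if Injective x then S₀ n x else 0)
    (htr : ∀ (n : ℕ) (v : EuclideanSpace ℝ (Fin 3)) (x : Fin n → EuclideanSpace ℝ (Fin 3)),
      Injective x → S₀ n (fun i => x i + v) = S₀ n x)
    (hrot : ∀ (n : ℕ) (R : EuclideanSpace ℝ (Fin 3) ≃ₗᵢ[ℝ] EuclideanSpace ℝ (Fin 3))
      (x : Fin n → EuclideanSpace ℝ (Fin 3)), Injective x → S₀ n (fun i => R (x i)) = S₀ n x)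
    (hsc : ∀ (n : ℕ) (c : ℝ), 0 < c → ∀ x : Fin n → EuclideanSpace ℝ (Fin 3), Injective x →
      S₀ n (fun i => c • x i) = c ^ (-(n : ℝ) * Δ) * S₀ n x)
    (hinv : ∀ (n : ℕ) (x : Fin n → EuclideanSpace ℝ (Fin 3)), Injective x → (∀ i, x i ≠ 0) →
      S₀ n (fun i => inversion 0 1 (x i)) = (∏ i, ‖x i‖ ^ (2 * Δ)) * S₀ n x) :
    IsMoebiusCovariant Δ S' := by
  refine ⟨⟨?_, ?_⟩, ?_, ?_⟩
  · intro n v x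
    have hiff : Injective (fun i => x i + v) ↔ Injective x :=
      (add_left_injective v).of_comp_iff x
    by_cases hx : Injective x
    · rw [hS', if_pos (hiff.2 hx), hS', if_pos hx, htr n v x hx]
    · rw [hS', if_neg (fun h => hx (hiff.1 h)), hS', if_neg hx]
  · intro n R x
    have hiff : Injective (fun i => R (x i)) ↔ Injective x := R.injective.of_comp_iff x
    by_cases hx : Injective x
    · rw [hS', if_pos (hiff.2 hx), hS', if_pos hx, hrot n R x hx]
    · rw [hS', if_neg (fun h => hx (hiff.1 h)), hS', if_neg hx]
  · intro n c hc x
    have hiff : Injective (fun i => c • x i) ↔ Injective x :=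
      (smul_right_injective (EuclideanSpace ℝ (Fin 3)) hc.ne').of_comp_iff x
    by_cases hx : Injective x
    · rw [hS', if_pos (hiff.2 hx), hS', if_pos hx, hsc n c hc x hx]
    · rw [hS', if_neg (fun h => hx (hiff.1 h)), hS', if_neg hx, mul_zero]
  · intro n x hx0
    have hiff : Injective (fun i => inversion 0 1 (x i)) ↔ Injective x :=
      (inversion_injective (0 : EuclideanSpace ℝ (Fin 3)) one_ne_zero).of_comp_iff x
    by_cases hx : Injective x
    · rw [hS', if_pos (hiff.2 hx), hS', if_pos hx, hinv n x hx hx0]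
    · rw [hS', if_neg (fun h => hx (hiff.1 h)), hS', if_neg hx, mul_zero]

end MoebiusRestrictionCurrentsTargetSuffices

open MoebiusRestrictionCurrentsTargetSuffices

/-! ### The glue theorem -/

/-- **Item `stmt-CriticalPhenomena-4860` (`TargetSuffices`).** The route target (domain Möbius
theory: existence of all renormalised free-b.c. critical `n`-point limits in every admissible
domain of `ℝ³`, positivity of the full-space two-point limit, and covariance of `(D, x) ↦ S^D_n(x)`
under translations, `O(3)`, dilations and the unit inversion), together with the shared
non-Gaussianity crux `IsingEuclidUpgradeR4NonGaussian` and the support `FreeIsCritical`, gives the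
conjunct `Ising3DConformalLimit` with `ρ = ρ₀`, the same `Δ`, and `S' := S univ` extended by `0`
off the non-coincident configurations. (Duminil-Copin, ICM 2022, §8.1; Di Francesco–Mathieu–Sénéchal
1997, §4.3.1.) [folklore] -/
theorem moebiusRestrictionCurrents_targetSuffices_proof :
    Summit.CriticalPhenomena.Ising3DConformalLimit.Theses.MoebiusRestrictionCurrents.TargetSuffices := by
  classical
  unfold TargetSuffices Target IsingEuclidUpgradeR4NonGaussian
  intro hT hNG hFree
  dsimp only at hT
  obtain ⟨Δ, S, hΔ, hconv, hpos, htrans, hrot, hscale, hinv⟩ := hT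
  -- the canonical renormalisation and the extended full-space family
  set ρ : ℝ → ℝ := fun δ => (Real.sqrt (criticalTwoPoint 3
    (latticeApprox δ (EuclideanSpace.single (0 : Fin 3) (1 : ℝ)))))⁻¹
  let S' : CorrFamily 3 := fun n x => if Injective x then S univ n x else 0
  have hS' : ∀ (n : ℕ) (x : Fin n → EuclideanSpace ℝ (Fin 3)),
      S' n x = if Injective x then S univ n x else 0 := fun _ _ => rfl
  have hρ : ∀ δ ∈ Set.Ioc (0 : ℝ) 1, 0 < ρ δ := fun δ _ => rho_pos δ
  have h0c : ({0}ᶜ : Set (EuclideanSpace ℝ (Fin 3))) ⊆ {0}ᶜ := subset_rfl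
  have h0u : ({0}ᶜ : Set (EuclideanSpace ℝ (Fin 3))) ⊆ univ := subset_univ _
  -- (1) the route's rescaled domain correlator is the rescaled critical correlator for `δ > 0`,
  --     so clause (i) is locally uniform convergence of `rescaledCorrelator (criticalCorr 3) ρ n`
  have hlimD : ∀ {D : Set (EuclideanSpace ℝ (Fin 3))},
      ({0}ᶜ : Set (EuclideanSpace ℝ (Fin 3))) ⊆ D →
      (IsOpen D ∧ volume (frontier D) = 0) → ∀ n : ℕ,
      TendstoLocallyUniformlyOn (rescaledCorrelator (criticalCorr 3) ρ n) (S D n) (𝓝[>] (0 : ℝ))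
        (NonCoincident 3 n ∩ {x | ∀ i, x i ∈ D}) := by
    intro D hD hadm n
    refine (hconv D hadm n).congr_inseparable ?_
    filter_upwards [self_mem_nhdsWithin] with δ hδ x _
    refine Inseparable.of_eq ?_
    rw [rescaledCorrelator_apply, limUnder_eq_criticalCorr hFree (ne_of_gt hδ) hD n x]
  -- (2) the scaling limit of `criticalCorr 3` under `ρ` is `S'`
  have hlim : HasPointwiseScalingLimit (criticalCorr 3) ρ S' := by
    intro n
    have h := (hlimD h0u adm_univ n).mono
      (s' := NonCoincident 3 n) (fun x hx => ⟨hx, fun i => mem_univ _⟩)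
    refine h.congr_right fun x hx => ?_
    rw [hS', if_pos ((mem_nonCoincident x).1 hx)]
  -- (3) non-degeneracy
  have hnd : IsNondegenerateTwoPoint S' := by
    intro x hx
    rw [hS', if_pos ((mem_nonCoincident x).1 hx)]
    exact hpos x hx
  -- (4) `S {0}ᶜ = S univ` on non-coincident configurations avoiding the origin
  have hSeq : ∀ (n : ℕ) (x : Fin n → EuclideanSpace ℝ (Fin 3)), Injective x → (∀ i, x i ≠ 0) →
      S {0}ᶜ n x = S univ n x := by
    intro n x hx hx0
    have h1 := hlimD h0c adm_compl_zero n
    have h2 := (hlimD h0u adm_univ n).mono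
      (s' := NonCoincident 3 n ∩ {x | ∀ i, x i ∈ ({0}ᶜ : Set (EuclideanSpace ℝ (Fin 3)))})
      (fun x hx => ⟨hx.1, fun i => mem_univ _⟩)
    exact h1.unique h2 ⟨(mem_nonCoincident x).2 hx, fun i => hx0 i⟩
  -- (5) Möbius covariance of `S'`
  have hι : inversion (0 : EuclideanSpace ℝ (Fin 3)) 1 '' ({0}ᶜ : Set (EuclideanSpace ℝ (Fin 3)))
      = {0}ᶜ := by
    rw [image_compl_eq (inversion_bijective _ one_ne_zero), image_singleton, inversion_self]
  have hM : IsMoebiusCovariant Δ S' := by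
    refine isMoebiusCovariant_extend (S univ) S' hS' ?_ ?_ ?_ ?_
    · intro n v x hx
      have h := htrans univ adm_univ n v x (fun i => mem_univ _) hx
      rwa [image_univ_of_surjective (add_right_surjective v)] at h
    · intro n R x hx
      have h := hrot univ adm_univ n R x (fun i => mem_univ _) hx
      rwa [image_univ_of_surjective R.surjective] at h
    · intro n c hc x hx
      have h := hscale univ adm_univ n c hc x (fun i => mem_univ _) hx
      rwa [image_univ_of_surjective] at h
      exact fun y => ⟨c⁻¹ • y, by simp [smul_smul, mul_inv_cancel₀ hc.ne']⟩
    · intro n x hx hx0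
      have h := hinv {0}ᶜ adm_compl_zero (fun h => h rfl) n x (fun i => hx0 i) hx
      rw [hι] at h
      have hinj : Injective (fun i => inversion 0 1 (x i)) :=
        ((inversion_injective (0 : EuclideanSpace ℝ (Fin 3)) one_ne_zero).of_comp_iff x).2 hx
      have hne : ∀ i, inversion (0 : EuclideanSpace ℝ (Fin 3)) 1 (x i) ≠ 0 := fun i h' =>
        hx0 i ((inversion_eq_center one_ne_zero).1 h')
      rw [← hSeq n _ hinj hne, h, hSeq n x hx hx0]
  -- (6) non-Gaussianity from the shared crux, and assembly
  have hU4 : HasNontrivialU4 S' := hNG ρ S' hρ hlim hnd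
  exact ⟨ρ, Δ, S', hρ, hΔ, hlim, hnd, hM, hU4⟩

end Summit.CriticalPhenomena.Ising3DConformalLimit.Theorems
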